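import Literature.Geometry.Lorentzian.FlatParallelFrame
import Literature.Geometry.Lorentzian.HypersurfaceRestriction
import Literature.Geometry.Lorentzian.TwoParameterMaps
import Literature.Geometry.Lorentzian.GeodesicSpeed
import Literature.Geometry.Lorentzian.GeodesicProofs
import Mathlib.Analysis.Calculus.LocalExtr.Basic
import Mathlib.Analysis.Calculus.Deriv.MeanValue
import Mathlib.Analysis.Calculus.Deriv.Shift
import HarnessLib

/-!
# Touching hypersurfaces have ordered second fundamental forms

The geometric maximum-principle inequality behind the comparison of (null) hypersurfaces
(Galloway 2000, §2; Chruściel–Delay–Galloway–Howard 2001, §4 and App. A), in the tree's language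
of `normalDerivAlong` / `secondFundamentalForm` (`Hypersurface.lean`): layer L4 (b) / L1 of the
proof programme of `Literature.Geometry.Lorentzian.ChruscielEtAl2001_areaTheorem` (brick B12d).

**Setting.** `M` is a manifold modelled on `𝓘(ℝ, E)` with a `C^n` pseudo-Riemannian metric `g`
whose Levi-Civita connection is locally `C^∞`; `Ψ : ℝ × F → M` is a smooth map near a point
("graph coordinates": think of a chart in which the `τ`-lines `τ ↦ Ψ(τ, ξ)` are timelike), and two
hypersurfaces are given as graphs `Φᵢ(ξ) = Ψ(fᵢ ξ, ξ)` of `C²` functions `f₁, f₂ : F → ℝ` which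
touch at `ξ₀` with `f₂ ≤ f₁` nearby. `Kᵢ` are normal fields along `Φᵢ` (`g(Kᵢ, dΦᵢ w) = 0`)
agreeing at the touching point and pairing negatively with the vertical `V = ∂_τΨ` there.

**Theorem** (`val_normalDerivAlong_le_of_touching`): for every direction `e`,
`g(D_e K₂, dΦ₂ e) ≤ g(D_e K₁, dΦ₁ e)` — the second fundamental forms with respect to `K`
(`χ_K(v, w) = g(D_v K, dΦ w)`) satisfy `χ₂(e, e) ≤ χ₁(e, e)`. No signature, nullity or dimension
hypothesis is needed. Ingredients, all proved here:

* `deriv2_nonneg_of_isLocalMin`, `deriv_line_eq_and_deriv2_le_of_touching` — one-variable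
  first/second-order conditions at the touching minimum of `f₁ - f₂`;
* `val_normalDerivAlong_eq_neg_val_acceleration` — `χ(e, e) = -g(K, acc)` with `acc` the covariant
  `s`-derivative of `∂_r Φ(ξ₀ + s e + r e)` (O'Neill 1983, Ch. 4, Cor. 9: `II(v,v) = nor γ''`);
* `covariantDerivAlong_line_eq_chart` — the chart formula `acc = ψ'' + Γ(ψ', ψ')` at the base
  point (`FlatParallelFrame.continuousLinearMapAt_covariantDerivAlong_symmL_Γmat`);
* `deriv_deriv_comp_curve` — `(G ∘ α)'' = D²G(α', α') + DG(α'')`, so that with equal 1-jets the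
  two accelerations differ by `((f₂ - f₁) ∘ ℓ)''(0) · V`.

No definitions, no named facts (D-0026).

## References

* G. J. Galloway, *Maximum principles for null hypersurfaces and null splitting theorems*,
  Ann. Henri Poincaré 1 (2000) 543–567, §2 (proof of Thm. 2.1).
* P. T. Chruściel, E. Delay, G. J. Galloway, R. Howard, *Regularity of horizons and the area
  theorem*, Ann. Henri Poincaré 2 (2001) 109–178, §4, App. A.
* B. O'Neill, *Semi-Riemannian geometry with applications to relativity* (1983), Ch. 3, Prop. 18;
  Ch. 4, Lemma 4, Cor. 9, p. 122.
-/

noncomputable section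

open Bundle Set Filter Function
open scoped Manifold ContDiff Topology

namespace Literature.Geometry.Lorentzian

/-! ### One-variable second-order condition at a local minimum -/

/-- **Second-order necessary condition at an interior local minimum**: if `φ` is differentiable
near `0` with derivative `φ'`, `φ'` is differentiable at `0` with derivative `a`, and `φ` has a
local minimum at `0`, then `0 ≤ a` — otherwise `φ'(0) = 0` and `φ' < 0` just to the right of `0`,
so `φ` would decrease there (mean value theorem). [folklore] -/
theorem deriv2_nonneg_of_isLocalMin {φ φ' : ℝ → ℝ} {a : ℝ}
    (hφ : ∀ᶠ s in 𝓝 (0 : ℝ), HasDerivAt φ (φ' s) s) (hφ' : HasDerivAt φ' a 0)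
    (hmin : IsLocalMin φ 0) : 0 ≤ a := by
  by_contra ha
  push Not at ha
  have h0 : φ' 0 = 0 := hmin.hasDerivAt_eq_zero hφ.self_of_nhds
  -- `φ' s < 0` for small `s > 0`
  have hslope : Tendsto (slope φ' 0) (𝓝[≠] (0 : ℝ)) (𝓝 a) := hasDerivAt_iff_tendsto_slope.1 hφ'
  have hneg : ∀ᶠ s in 𝓝[>] (0 : ℝ), φ' s < 0 := by
    have h1 : ∀ᶠ s in 𝓝[≠] (0 : ℝ), slope φ' 0 s < a / 2 :=
      hslope (Iio_mem_nhds (by linarith))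
    have h2 : ∀ᶠ s in 𝓝[>] (0 : ℝ), slope φ' 0 s < a / 2 :=
      nhdsWithin_mono _ (fun s hs ↦ ne_of_gt hs) h1
    filter_upwards [h2, self_mem_nhdsWithin] with s hs hs0
    rw [slope_def_field, h0, sub_zero, sub_zero] at hs
    have hs0' : (0 : ℝ) < s := hs0
    have hlt : φ' s / s < 0 := lt_trans hs (by linarith)
    by_contra hge
    push Not at hge
    exact absurd (div_nonneg hge hs0'.le) (not_le.2 hlt)
  -- choose `s₀ > 0` with: minimum inequality on `[0, s₀]`, differentiability on `[0, s₀]`, `φ' < 0` on `(0, s₀]`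
  obtain ⟨ε₁, hε₁, hε₁s⟩ := Metric.eventually_nhds_iff.1 (hmin.and hφ)
  obtain ⟨ε₂, hε₂, hε₂s⟩ : ∃ ε > 0, ∀ s, 0 < s → s < ε → φ' s < 0 := by
    rcases (nhdsWithin_hasBasis Metric.nhds_basis_ball (Ioi (0 : ℝ))).eventually_iff.1 hneg with
      ⟨ε, hε, h⟩
    refine ⟨ε, hε, fun s hs hsε ↦ h ⟨?_, hs⟩⟩
    rw [Metric.mem_ball, Real.dist_eq, sub_zero, abs_of_pos hs]
    exact hsε
  set s₀ : ℝ := min ε₁ ε₂ / 2 with hs₀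
  have hs₀pos : 0 < s₀ := by rw [hs₀]; positivity
  have hs₀ε₁ : s₀ < ε₁ := by
    rw [hs₀]; linarith [min_le_left ε₁ ε₂]
  have hs₀ε₂ : s₀ < ε₂ := by
    rw [hs₀]; linarith [min_le_right ε₁ ε₂]
  have hball : ∀ s ∈ Icc 0 s₀, dist s 0 < ε₁ := fun s hs ↦ by
    rw [Real.dist_eq, sub_zero, abs_of_nonneg hs.1]
    exact lt_of_le_of_lt hs.2 hs₀ε₁
  have hdiff : ∀ s ∈ Icc 0 s₀, HasDerivAt φ (φ' s) s := fun s hs ↦ (hε₁s (hball s hs)).2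
  obtain ⟨ξ, hξ, hξeq⟩ := exists_hasDerivAt_eq_slope φ φ' hs₀pos
    (fun s hs ↦ (hdiff s hs).continuousAt.continuousWithinAt)
    (fun s hs ↦ hdiff s (Ioo_subset_Icc_self hs))
  have hξneg : φ' ξ < 0 := hε₂s ξ hξ.1 (hξ.2.trans hs₀ε₂)
  have hmin' : φ 0 ≤ φ s₀ := (hε₁s (hball s₀ ⟨hs₀pos.le, le_rfl⟩)).1
  rw [hξeq, sub_zero] at hξneg
  have : φ s₀ - φ 0 < 0 := by
    have h := mul_neg_of_neg_of_pos hξneg hs₀pos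
    rwa [div_mul_cancel₀ _ hs₀pos.ne'] at h
  linarith

/-- **At a touching point of `f₂ ≤ f₁` the differentials agree and the second directional
derivatives are ordered.** If `f₂ ≤ f₁` near `ξ₀` with `f₁ ξ₀ = f₂ ξ₀`, both `C²` near `ξ₀`, then
along every line `s ↦ ξ₀ + s e`: `(f₁ ∘ c)'(0) = (f₂ ∘ c)'(0)` and `(f₂ ∘ c)''(0) ≤ (f₁ ∘ c)''(0)`.
[folklore] -/
theorem deriv_line_eq_and_deriv2_le_of_touching {F : Type*} [NormedAddCommGroup F]
    [NormedSpace ℝ F] {f₁ f₂ : F → ℝ} {ξ₀ : F}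
    (hf₁ : ∀ᶠ ξ in 𝓝 ξ₀, ContDiffAt ℝ 2 f₁ ξ) (hf₂ : ∀ᶠ ξ in 𝓝 ξ₀, ContDiffAt ℝ 2 f₂ ξ)
    (htouch : f₁ ξ₀ = f₂ ξ₀) (hle : ∀ᶠ ξ in 𝓝 ξ₀, f₂ ξ ≤ f₁ ξ) (e : F) :
    deriv (fun s : ℝ ↦ f₁ (ξ₀ + s • e)) 0 = deriv (fun s : ℝ ↦ f₂ (ξ₀ + s • e)) 0 ∧
      deriv (deriv fun s : ℝ ↦ f₂ (ξ₀ + s • e)) 0 ≤ deriv (deriv fun s : ℝ ↦ f₁ (ξ₀ + s • e)) 0 := by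
  -- the line and the restrictions
  set c : ℝ → F := fun s ↦ ξ₀ + s • e with hc
  have hc0 : c 0 = ξ₀ := by simp [hc]
  have hcd : ∀ s, HasDerivAt c e s := fun s ↦ by
    have h : HasDerivAt (fun y : ℝ ↦ ξ₀ + y • e) ((1 : ℝ) • e) s :=
      ((hasDerivAt_id' s).smul_const e).const_add ξ₀
    rw [one_smul] at h
    exact h
  have hccont : Continuous c := (continuous_const.add (continuous_id.smul continuous_const))
  have hct : Tendsto c (𝓝 0) (𝓝 ξ₀) := by rw [← hc0]; exact hccont.continuousAt
  -- `φᵢ = fᵢ ∘ c` are `C²` near `0`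
  have hφ : ∀ {f : F → ℝ}, (∀ᶠ ξ in 𝓝 ξ₀, ContDiffAt ℝ 2 f ξ) →
      ∀ᶠ s in 𝓝 (0 : ℝ), ContDiffAt ℝ 2 (fun s : ℝ ↦ f (c s)) s := fun hf ↦ by
    filter_upwards [hct.eventually hf] with s hs
    exact hs.comp s ((contDiff_const.add (contDiff_id.smul contDiff_const)).contDiffAt)
  have hderiv : ∀ {f : F → ℝ}, (∀ᶠ ξ in 𝓝 ξ₀, ContDiffAt ℝ 2 f ξ) →
      (∀ᶠ s in 𝓝 (0 : ℝ), HasDerivAt (fun s : ℝ ↦ f (c s)) (deriv (fun s : ℝ ↦ f (c s)) s) s) ∧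
      HasDerivAt (deriv fun s : ℝ ↦ f (c s)) (deriv (deriv fun s : ℝ ↦ f (c s)) 0) 0 := by
    intro f hf
    have h2 := hφ hf
    refine ⟨h2.mono fun s hs ↦ (hs.differentiableAt (by norm_num)).hasDerivAt, ?_⟩
    have h1 : ContDiffAt ℝ 1 (deriv fun s : ℝ ↦ f (c s)) 0 := by
      have h := (h2.self_of_nhds).fderiv_right (m := 1) (by norm_num)
      -- `deriv φ = fderiv φ · 1`
      have hd : (deriv fun s : ℝ ↦ f (c s)) = fun s ↦ fderiv ℝ (fun s : ℝ ↦ f (c s)) s 1 := by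
        funext s; rfl
      rw [hd]
      exact h.clm_apply contDiffAt_const
    exact (h1.differentiableAt (by norm_num)).hasDerivAt
  obtain ⟨hφ₁, hφ₁'⟩ := hderiv hf₁
  obtain ⟨hφ₂, hφ₂'⟩ := hderiv hf₂
  -- `h = φ₁ - φ₂ ≥ 0` near `0` with `h 0 = 0`: a local minimum
  have hmin : IsLocalMin (fun s : ℝ ↦ f₁ (c s) - f₂ (c s)) 0 := by
    have hev : ∀ᶠ s in 𝓝 (0 : ℝ), f₂ (c s) ≤ f₁ (c s) := hct.eventually hle
    filter_upwards [hev] with s hs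
    simp only [hc0, htouch, sub_self]
    linarith
  have hh : ∀ᶠ s in 𝓝 (0 : ℝ), HasDerivAt (fun s : ℝ ↦ f₁ (c s) - f₂ (c s))
      (deriv (fun s : ℝ ↦ f₁ (c s)) s - deriv (fun s : ℝ ↦ f₂ (c s)) s) s := by
    filter_upwards [hφ₁, hφ₂] with s h1 h2
    exact h1.sub h2
  have hh' : HasDerivAt (fun s ↦ deriv (fun s : ℝ ↦ f₁ (c s)) s - deriv (fun s : ℝ ↦ f₂ (c s)) s)
      (deriv (deriv fun s : ℝ ↦ f₁ (c s)) 0 - deriv (deriv fun s : ℝ ↦ f₂ (c s)) 0) 0 :=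
    hφ₁'.sub hφ₂'
  refine ⟨?_, ?_⟩
  · have h := hmin.hasDerivAt_eq_zero hh.self_of_nhds
    linarith
  · have h := deriv2_nonneg_of_isLocalMin hh hh' hmin
    linarith

/-! ### The comparison of second fundamental forms -/

section Comparison

variable {E : Type*} [NormedAddCommGroup E] [NormedSpace ℝ E] [FiniteDimensional ℝ E]
  [CompleteSpace E] {M : Type*} [TopologicalSpace M] [ChartedSpace E M] [IsManifold 𝓘(ℝ, E) ∞ M]
  {n : ℕ∞ω} [Fact (1 ≤ n)] (g : PseudoRiemannianMetric 𝓘(ℝ, E) n E (TangentSpace 𝓘(ℝ, E) : M → Type _))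
  [g.HasLeviCivita]
  {F : Type*} [NormedAddCommGroup F] [NormedSpace ℝ F]

/-! #### Transport of cross-fibre quantities along equal base points -/

omit [FiniteDimensional ℝ E] [CompleteSpace E] [Fact (1 ≤ n)] [g.HasLeviCivita] in
/-- The metric pairing of two model-space vectors read at equal base points agrees. [folklore] -/
private theorem val_congr_point {p q : M} (h : p = q) (u v : E) :
    g.val p u v = g.val q u v := by
  subst h
  rfl

omit [FiniteDimensional ℝ E] [CompleteSpace E] [IsManifold 𝓘(ℝ, E) ∞ M]
  [NormedAddCommGroup F] [NormedSpace ℝ F] in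
/-- A field along a map, read in the model space, takes equal values at equal parameters. [folklore] -/
theorem field_congr_point {Φ : F → M} (K : Π ξ : F, TangentSpace 𝓘(ℝ, E) (Φ ξ)) {ξ ξ' : F}
    (h : ξ = ξ') : (K ξ : E) = K ξ' := by
  subst h
  rfl

omit [FiniteDimensional ℝ E] [CompleteSpace E] [IsManifold 𝓘(ℝ, E) ∞ M] in
/-- The differential of a map, read in the model spaces, agrees at equal base points. [folklore] -/
theorem mfderiv_congr_point' (Φ : F → M) {ξ ξ' : F} (h : ξ = ξ') (e : F) :
    (mfderiv 𝓘(ℝ, F) 𝓘(ℝ, E) Φ ξ e : E) = mfderiv 𝓘(ℝ, F) 𝓘(ℝ, E) Φ ξ' e := by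
  subst h
  rfl

omit [FiniteDimensional ℝ E] [CompleteSpace E] [Fact (1 ≤ n)] [g.HasLeviCivita]
  [NormedAddCommGroup F] [NormedSpace ℝ F] in
/-- The trivialisation of `TM` at `x₁` is the identity on the fibre over `x₁` (and over any point
equal to it). [folklore] -/
theorem trivializationAt_snd_of_eq {x₁ p : M} (h : p = x₁) (v : E) :
    ((trivializationAt E (TangentSpace 𝓘(ℝ, E)) x₁ ⟨p, v⟩).2 : E) = v := by
  subst h
  have h1 := (tangentBundleCore 𝓘(ℝ, E) M).coordChange_self (achart E p) p (mem_achart_source E p) v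
  rw [tangentBundleCore_coordChange_achart] at h1
  rw [TangentBundle.trivializationAt_apply]
  exact h1

omit [FiniteDimensional ℝ E] [CompleteSpace E] [Fact (1 ≤ n)] [g.HasLeviCivita]
  [NormedAddCommGroup F] [NormedSpace ℝ F] in
/-- The linear part of the trivialisation of `TM` at `x₁` is the identity over `x₁` (and over any
point equal to it). [folklore] -/
theorem continuousLinearMapAt_of_eq {x₁ p : M} (h : p = x₁) (v : E) :
    ((trivializationAt E (TangentSpace 𝓘(ℝ, E)) x₁).continuousLinearMapAt ℝ p v : E) = v := by
  have hb : p ∈ (trivializationAt E (TangentSpace 𝓘(ℝ, E)) x₁).baseSet := by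
    rw [h]; exact FiberBundle.mem_baseSet_trivializationAt' x₁
  rw [Trivialization.continuousLinearMapAt_apply_of_mem (R := ℝ) _ hb]
  exact trivializationAt_snd_of_eq h v

/-! #### The second fundamental form via accelerations of curves in the hypersurface -/

/-- **The second fundamental form via accelerations of curves in the hypersurface.** Let
`Φ : F → M` be `C²` near `ξ₀`, `K` a field along `Φ` whose lift is differentiable at `ξ₀` and
which is normal to `Φ` near `ξ₀` (`g(K ξ, dΦ_ξ w) = 0`). For the two-parameter map
`x(s, r) = Φ(ξ₀ + s e + r e)` (so `∂_r x(s, 0) = dΦ e` along the line `s ↦ ξ₀ + s e`):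
`g(D_e K, dΦ_{ξ₀} e) = -g(K, D_s ∂_r x (0, 0))` — the normal-derivative pairing is minus the pairing
of the normal with the covariant `s`-derivative of the pushed-forward field `dΦ e`, i.e. with the
acceleration of `Φ` along the line (differentiate `g(K, ∂_r x) ≡ 0`; O'Neill 1983, Ch. 4, Lemma 4 /
Cor. 9: `II(v, v) = nor γ''`). Both sides are read in the model space `E`.
[cite: ONeillSemiRiemannian1983, Ch. 4, Lemma 4 and Cor. 9] -/
theorem val_normalDerivAlong_eq_neg_val_acceleration {Φ : F → M}
    {K : Π ξ : F, TangentSpace 𝓘(ℝ, E) (Φ ξ)} {ξ₀ : F}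
    (hΦ : ∀ᶠ ξ in 𝓝 ξ₀, ContMDiffAt 𝓘(ℝ, F) 𝓘(ℝ, E) 2 Φ ξ)
    (hK : MDifferentiableAt 𝓘(ℝ, F) 𝓘(ℝ, E).tangent
      (fun ξ ↦ (TotalSpace.mk' E (Φ ξ) (K ξ) : TangentBundle 𝓘(ℝ, E) M)) ξ₀)
    (hKn : ∀ᶠ ξ in 𝓝 ξ₀, ∀ w : F, g.val (Φ ξ) (K ξ) (mfderiv 𝓘(ℝ, F) 𝓘(ℝ, E) Φ ξ w) = 0) (e : F) :
    g.val (Φ ξ₀) (g.normalDerivAlong (I' := 𝓘(ℝ, F)) Φ K ξ₀ e) (mfderiv 𝓘(ℝ, F) 𝓘(ℝ, E) Φ ξ₀ e) =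
      -g.val (Φ (ξ₀ + (0 : ℝ) • e + (0 : ℝ) • e)) (K (ξ₀ + (0 : ℝ) • e + (0 : ℝ) • e))
        (covariantDerivAlong g.leviCivita (fun s : ℝ ↦ Φ (ξ₀ + s • e + (0 : ℝ) • e))
          (fun s ↦ velocity 𝓘(ℝ, E) (fun r : ℝ ↦ Φ (ξ₀ + s • e + r • e)) 0) 0) := by
  have hLC := PseudoRiemannianMetric.isLeviCivita_leviCivita_holds (g := g)
  -- the two-parameter map and the line
  set x : ℝ → ℝ → M := fun s r ↦ Φ (ξ₀ + s • e + r • e) with hx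
  set c : ℝ → F := fun s ↦ ξ₀ + s • e + (0 : ℝ) • e with hc
  have hc0 : c 0 = ξ₀ := by simp [hc]
  have hcurve : ∀ s, curveThrough 𝓘(ℝ, F) ξ₀ e s = c s := fun s ↦ by
    simp [curveThrough, hc]
  have hlin : ContMDiff (𝓘(ℝ, ℝ).prod 𝓘(ℝ, ℝ)) 𝓘(ℝ, F) ∞ (fun q : ℝ × ℝ ↦ ξ₀ + q.1 • e + q.2 • e) := by
    have h : ContDiff ℝ ∞ (fun q : ℝ × ℝ ↦ ξ₀ + q.1 • e + q.2 • e) :=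
      (contDiff_const.add (contDiff_fst.smul contDiff_const)).add (contDiff_snd.smul contDiff_const)
    have h' := h.contMDiff
    rw [modelWithCornersSelf_prod, ← chartedSpaceSelf_prod] at h'
    exact h'
  have hcm : ∀ s, MDifferentiableAt 𝓘(ℝ, ℝ) 𝓘(ℝ, F) c s := fun s ↦
    ((hlin (s, 0)).comp s (contMDiffAt_id.prodMk contMDiffAt_const)).mdifferentiableAt (by simp)
  have hct : Tendsto c (𝓝 0) (𝓝 ξ₀) := by rw [← hc0]; exact (hcm 0).continuousAt
  -- smoothness of `x` near `(0, 0)`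
  have h00 : ξ₀ + (0 : ℝ) • e + (0 : ℝ) • e = ξ₀ := by simp
  have hxsm : ∀ᶠ q : ℝ × ℝ in 𝓝 ((0 : ℝ), (0 : ℝ)),
      ContMDiffAt (𝓘(ℝ, ℝ).prod 𝓘(ℝ, ℝ)) 𝓘(ℝ, E) 2 (uncurry x) q := by
    have hcont : ContinuousAt (fun q : ℝ × ℝ ↦ ξ₀ + q.1 • e + q.2 • e) (0, 0) :=
      hlin.continuous.continuousAt
    have hev := hcont.preimage_mem_nhds
      (show {ξ | ContMDiffAt 𝓘(ℝ, F) 𝓘(ℝ, E) 2 Φ ξ} ∈ 𝓝 (ξ₀ + (0 : ℝ) • e + (0 : ℝ) • e) by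
        rw [h00]; exact hΦ)
    have h2le : (2 : ℕ∞ω) ≤ ∞ := WithTop.coe_le_coe.2 le_top
    filter_upwards [hev] with q hq
    exact (show ContMDiffAt 𝓘(ℝ, F) 𝓘(ℝ, E) 2 Φ (ξ₀ + q.1 • e + q.2 • e) from hq).comp q
      ((hlin q).of_le h2le)
  have hx2 : ContMDiffAt (𝓘(ℝ, ℝ).prod 𝓘(ℝ, ℝ)) 𝓘(ℝ, E) 2 (uncurry x) (0, 0) := hxsm.self_of_nhds
  -- `∂_r x(s, 0) = dΦ_{c s} e` for `s` near `0`
  have hU : ∀ᶠ s in 𝓝 (0 : ℝ),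
      velocity 𝓘(ℝ, E) (x s) 0 = mfderiv 𝓘(ℝ, F) 𝓘(ℝ, E) Φ (c s) e := by
    filter_upwards [hct.eventually hΦ] with s hs
    have hline : HasMFDerivAt 𝓘(ℝ, ℝ) 𝓘(ℝ, F) (fun r : ℝ ↦ ξ₀ + s • e + r • e) 0
        (ContinuousLinearMap.smulRight (1 : ℝ →L[ℝ] ℝ) e) := by
      have h : HasDerivAt (fun r : ℝ ↦ ξ₀ + s • e + r • e) ((1 : ℝ) • e) 0 :=
        ((hasDerivAt_id' (0 : ℝ)).smul_const e).const_add (ξ₀ + s • e)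
      rw [one_smul] at h
      exact hasMFDerivAt_iff_hasFDerivAt.2 h.hasFDerivAt
    have hΦd : MDifferentiableAt 𝓘(ℝ, F) 𝓘(ℝ, E) Φ (ξ₀ + s • e + (0 : ℝ) • e) :=
      hs.mdifferentiableAt (by norm_num)
    simp only [velocity]
    rw [show (x s) = Φ ∘ (fun r : ℝ ↦ ξ₀ + s • e + r • e) from rfl,
      mfderiv_comp (0 : ℝ) hΦd hline.mdifferentiableAt, hline.mfderiv]
    have h1 : (ContinuousLinearMap.smulRight (1 : ℝ →L[ℝ] ℝ) e : ℝ → F) 1 = e := by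
      simp
    exact congrArg (fun v : F ↦ (mfderiv 𝓘(ℝ, F) 𝓘(ℝ, E) Φ (ξ₀ + s • e + (0 : ℝ) • e) v : E)) h1
  -- lifts: `s ↦ (x s 0, ∂_r x(s,0))` and `s ↦ (Φ (c s), K (c s))`
  have hVl : MDifferentiableAt 𝓘(ℝ, ℝ) 𝓘(ℝ, E).tangent
      (fun s ↦ (TotalSpace.mk' E (x s 0) (velocity 𝓘(ℝ, E) (x s) 0) :
        TangentBundle 𝓘(ℝ, E) M)) 0 :=
    mdifferentiableAt_lift_velocity_curry_right hx2
  have hKl : MDifferentiableAt 𝓘(ℝ, ℝ) 𝓘(ℝ, E).tangent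
      (fun s ↦ (TotalSpace.mk' E (x s 0) (K (c s)) : TangentBundle 𝓘(ℝ, E) M)) 0 := by
    have hK' : MDifferentiableAt 𝓘(ℝ, F) 𝓘(ℝ, E).tangent
        (fun ξ ↦ (TotalSpace.mk' E (Φ ξ) (K ξ) : TangentBundle 𝓘(ℝ, E) M)) (c 0) := by
      rw [hc0]; exact hK
    exact hK'.comp 0 (hcm 0)
  -- the pairing `g(K(c s), ∂_r x(s, 0))` vanishes near `0`, hence has zero derivative
  have hzero : ∀ᶠ s in 𝓝 (0 : ℝ),
      g.val (x s 0) (K (c s)) (velocity 𝓘(ℝ, E) (x s) 0) = 0 := by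
    filter_upwards [hU, hct.eventually hKn] with s hs hn
    rw [hs]
    exact hn e
  have hder := g.hasDerivAt_val_apply_along hLC.2 hKl hVl
  have hder0 : HasDerivAt (fun s ↦ g.val (x s 0) (K (c s)) (velocity 𝓘(ℝ, E) (x s) 0)) 0 0 :=
    (hasDerivAt_const (0 : ℝ) (0 : ℝ)).congr_of_eventuallyEq hzero
  have hsum := hder.unique hder0
  -- identify the normal derivative and the differential at `ξ₀`
  have hnd : (g.normalDerivAlong (I' := 𝓘(ℝ, F)) Φ K ξ₀ e : E) =
      covariantDerivAlong g.leviCivita (fun s ↦ x s 0) (fun s ↦ K (c s)) 0 := by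
    change covariantDerivAlong g.leviCivita (Φ ∘ curveThrough 𝓘(ℝ, F) ξ₀ e)
      (fun t ↦ K (curveThrough 𝓘(ℝ, F) ξ₀ e t)) 0 = _
    refine covariantDerivAlong_congr_of_eventuallyEq g.leviCivita (Eventually.of_forall fun s ↦ ?_)
    exact congrArg (fun ξ ↦ (TotalSpace.mk' E (Φ ξ) (K ξ) : TangentBundle 𝓘(ℝ, E) M)) (hcurve s)
  have hdΦ : (mfderiv 𝓘(ℝ, F) 𝓘(ℝ, E) Φ ξ₀ e : E) = velocity 𝓘(ℝ, E) (x 0) 0 := by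
    rw [hU.self_of_nhds]
    exact mfderiv_congr_point' Φ hc0.symm e
  rw [val_congr_point g (show Φ ξ₀ = x 0 0 by rw [← hc0]) , hnd, hdΦ]
  have hK0 : (K (ξ₀ + (0 : ℝ) • e + (0 : ℝ) • e) : E) = K (c 0) := rfl
  linarith [hsum]

/-! #### One-variable chain rules of first and second order -/

omit [FiniteDimensional ℝ E] [CompleteSpace E] [Fact (1 ≤ n)] [g.HasLeviCivita] [IsManifold 𝓘(ℝ, E) ∞ M]
  [ChartedSpace E M] [TopologicalSpace M] in
/-- **First and second derivative of `G ∘ α` at `0`** for a `C²` map `G` (near `α 0 = p`) and a curve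
`α` with derivative `α'` near `0`, `α'` having derivative `α''` at `0`:
`(G ∘ α)' = DG(α)·α'` near `0`, `(G ∘ α)'(0) = DG(p) α'(0)` and
`(G ∘ α)''(0) = D²G(p)(α'(0))(α'(0)) + DG(p) α''`. [folklore] -/
theorem deriv_deriv_comp_curve {P : Type*} [NormedAddCommGroup P] [NormedSpace ℝ P] {G : P → E}
    {p : P} (hG : ∀ᶠ q in 𝓝 p, ContDiffAt ℝ 2 G q) {α α' : ℝ → P} {α'' : P}
    (hα : ∀ᶠ t in 𝓝 (0 : ℝ), HasDerivAt α (α' t) t) (hα' : HasDerivAt α' α'' 0) (h0 : α 0 = p) :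
    (deriv (G ∘ α) =ᶠ[𝓝 0] fun t ↦ fderiv ℝ G (α t) (α' t)) ∧
      deriv (G ∘ α) 0 = fderiv ℝ G p (α' 0) ∧
      deriv (deriv (G ∘ α)) 0 = fderiv ℝ (fderiv ℝ G) p (α' 0) (α' 0) + fderiv ℝ G p α'' := by
  subst h0
  have hαt : Tendsto α (𝓝 0) (𝓝 (α 0)) := (hα.self_of_nhds).continuousAt
  -- first order, near `0`
  have h1 : deriv (G ∘ α) =ᶠ[𝓝 0] fun t ↦ fderiv ℝ G (α t) (α' t) := by
    filter_upwards [hα, hαt.eventually hG] with t ht hGt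
    exact ((hGt.differentiableAt (by norm_num)).hasFDerivAt.comp_hasDerivAt t ht).deriv
  refine ⟨h1, ?_, ?_⟩
  · exact h1.self_of_nhds
  · -- second order at `0`
    have hG0 : ContDiffAt ℝ 2 G (α 0) := hG.self_of_nhds
    have hD2 : HasFDerivAt (fderiv ℝ G) (fderiv ℝ (fderiv ℝ G) (α 0)) (α 0) :=
      ((hG0.fderiv_right (m := 1) (by norm_num)).differentiableAt one_ne_zero).hasFDerivAt
    have hcomp : HasDerivAt (fun t ↦ fderiv ℝ G (α t)) (fderiv ℝ (fderiv ℝ G) (α 0) (α' 0)) 0 :=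
      hD2.comp_hasDerivAt 0 hα.self_of_nhds
    have h2 := hcomp.clm_apply hα'
    rw [h1.deriv_eq]
    exact h2.deriv

/-- **Derivatives of the restriction of `f` to a line**: if `f` is `C²` near `ξ₀` then along
`ℓ(t) = ξ₀ + t e` the function `f ∘ ℓ` has derivative `deriv (f ∘ ℓ)` near `0`, and
`deriv (f ∘ ℓ)` is differentiable at `0`. [folklore] -/
theorem hasDerivAt_line_of_contDiffAt {f : F → ℝ} {ξ₀ : F}
    (hf : ∀ᶠ ξ in 𝓝 ξ₀, ContDiffAt ℝ 2 f ξ) (e : F) :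
    (∀ᶠ s in 𝓝 (0 : ℝ), HasDerivAt (fun s : ℝ ↦ f (ξ₀ + s • e))
        (deriv (fun s : ℝ ↦ f (ξ₀ + s • e)) s) s) ∧
      HasDerivAt (deriv fun s : ℝ ↦ f (ξ₀ + s • e))
        (deriv (deriv fun s : ℝ ↦ f (ξ₀ + s • e)) 0) 0 := by
  have hct : Tendsto (fun s : ℝ ↦ ξ₀ + s • e) (𝓝 0) (𝓝 ξ₀) := by
    have h : Continuous (fun s : ℝ ↦ ξ₀ + s • e) :=
      continuous_const.add (continuous_id.smul continuous_const)
    have h0 : ξ₀ + (0 : ℝ) • e = ξ₀ := by simp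
    have h1 : ContinuousAt (fun s : ℝ ↦ ξ₀ + s • e) 0 := h.continuousAt
    rwa [ContinuousAt, h0] at h1
  have h2 : ∀ᶠ s in 𝓝 (0 : ℝ), ContDiffAt ℝ 2 (fun s : ℝ ↦ f (ξ₀ + s • e)) s := by
    filter_upwards [hct.eventually hf] with s hs
    exact hs.comp s ((contDiff_const.add (contDiff_id.smul contDiff_const)).contDiffAt)
  refine ⟨h2.mono fun s hs ↦ (hs.differentiableAt (by norm_num)).hasDerivAt, ?_⟩
  have h1 : ContDiffAt ℝ 1 (deriv fun s : ℝ ↦ f (ξ₀ + s • e)) 0 := by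
    have h := (h2.self_of_nhds).fderiv_right (m := 1) (by norm_num)
    have hd : (deriv fun s : ℝ ↦ f (ξ₀ + s • e)) =
        fun s ↦ fderiv ℝ (fun s : ℝ ↦ f (ξ₀ + s • e)) s 1 := by
      funext s; rfl
    rw [hd]
    exact h.clm_apply contDiffAt_const
  exact (h1.differentiableAt (by norm_num)).hasDerivAt

/-! #### The acceleration of `Φ` along a line, in the chart at its base point -/

omit [CompleteSpace E] [Fact (1 ≤ n)] in
/-- **Chart formula for the acceleration of `Φ` along a line.** Let `Φ : F → M` be `C²` near
`ξ₀`, `x₁ = Φ(ξ₀)` (up to the syntactic form `ξ₀ + 0 e + 0 e`), and `ψ(t) = φ(Φ(ξ₀ + t e))` the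
chart expression of `Φ` along the line (`φ` the extended chart at `x₁`). Then the covariant
`s`-derivative at `0` of the pushed-forward field `∂_r Φ(ξ₀ + s e + r e)|_{r=0}` along
`s ↦ Φ(ξ₀ + s e)`, read in the model space, is `ψ''(0) + Γ(x₁)(ψ'(0))(ψ'(0))` with the
connection matrix `Γmat` of the Levi-Civita connection in the chart at `x₁` (the coordinate formula
`D_s Z = Ż + Γ(γ', Z)` of O'Neill 1983, Ch. 3, Prop. 18 and Ch. 4, p. 122;
`continuousLinearMapAt_covariantDerivAlong_symmL_Γmat`). [cite: ONeillSemiRiemannian1983, Ch. 3, Prop. 18; Ch. 4, p. 122] -/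
theorem covariantDerivAlong_line_eq_chart (hreg : g.leviCivita.IsLocallyContMDiff ∞)
    {Φ : F → M} {ξ₀ : F} (e : F) (hΦ : ∀ᶠ ξ in 𝓝 ξ₀, ContMDiffAt 𝓘(ℝ, F) 𝓘(ℝ, E) 2 Φ ξ)
    {x₁ : M} (hx₁ : Φ (ξ₀ + (0 : ℝ) • e + (0 : ℝ) • e) = x₁) :
    (covariantDerivAlong g.leviCivita (fun s : ℝ ↦ Φ (ξ₀ + s • e + (0 : ℝ) • e))
        (fun s ↦ velocity 𝓘(ℝ, E) (fun r : ℝ ↦ Φ (ξ₀ + s • e + r • e)) 0) 0 : E) =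
      deriv (deriv fun t : ℝ ↦ extChartAt 𝓘(ℝ, E) x₁ (Φ (ξ₀ + t • e))) 0 +
        Γmat g.leviCivita hreg x₁ x₁ (deriv (fun t : ℝ ↦ extChartAt 𝓘(ℝ, E) x₁ (Φ (ξ₀ + t • e))) 0)
          (deriv (fun t : ℝ ↦ extChartAt 𝓘(ℝ, E) x₁ (Φ (ξ₀ + t • e))) 0) := by
  subst hx₁
  set x : ℝ → ℝ → M := fun s r ↦ Φ (ξ₀ + s • e + r • e) with hx
  set γ : ℝ → M := fun s ↦ x s 0 with hγ
  set ex := trivializationAt E (TangentSpace 𝓘(ℝ, E) : M → Type _) (γ 0) with hex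
  set ψ : ℝ → E := fun t ↦ extChartAt 𝓘(ℝ, E) (γ 0) (Φ (ξ₀ + t • e)) with hψ
  -- smoothness of `x` near `(s, 0)` for `s` near `0`
  have hlin : ContMDiff (𝓘(ℝ, ℝ).prod 𝓘(ℝ, ℝ)) 𝓘(ℝ, F) ∞ (fun q : ℝ × ℝ ↦ ξ₀ + q.1 • e + q.2 • e) := by
    have h : ContDiff ℝ ∞ (fun q : ℝ × ℝ ↦ ξ₀ + q.1 • e + q.2 • e) :=
      (contDiff_const.add (contDiff_fst.smul contDiff_const)).add (contDiff_snd.smul contDiff_const)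
    have h' := h.contMDiff
    rw [modelWithCornersSelf_prod, ← chartedSpaceSelf_prod] at h'
    exact h'
  have h2le : (2 : ℕ∞ω) ≤ ∞ := WithTop.coe_le_coe.2 le_top
  have h00 : ξ₀ + (0 : ℝ) • e + (0 : ℝ) • e = ξ₀ := by simp
  have hxsm : ∀ᶠ q : ℝ × ℝ in 𝓝 ((0 : ℝ), (0 : ℝ)),
      ContMDiffAt (𝓘(ℝ, ℝ).prod 𝓘(ℝ, ℝ)) 𝓘(ℝ, E) 2 (uncurry x) q := by
    have hcont : ContinuousAt (fun q : ℝ × ℝ ↦ ξ₀ + q.1 • e + q.2 • e) (0, 0) :=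
      hlin.continuous.continuousAt
    have hev := hcont.preimage_mem_nhds
      (show {ξ | ContMDiffAt 𝓘(ℝ, F) 𝓘(ℝ, E) 2 Φ ξ} ∈ 𝓝 (ξ₀ + (0 : ℝ) • e + (0 : ℝ) • e) by
        rw [h00]; exact hΦ)
    filter_upwards [hev] with q hq
    exact (show ContMDiffAt 𝓘(ℝ, F) 𝓘(ℝ, E) 2 Φ (ξ₀ + q.1 • e + q.2 • e) from hq).comp q
      ((hlin q).of_le h2le)
  have hline0 : Tendsto (fun s : ℝ ↦ ((s, (0 : ℝ)) : ℝ × ℝ)) (𝓝 0) (𝓝 (0, 0)) :=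
    (continuous_id.prodMk continuous_const).continuousAt
  have hxs : ∀ᶠ s in 𝓝 (0 : ℝ), ContMDiffAt (𝓘(ℝ, ℝ).prod 𝓘(ℝ, ℝ)) 𝓘(ℝ, E) 2 (uncurry x) (s, 0) :=
    hline0.eventually hxsm
  -- differentiability of `γ` and of the `r`-curves near `0`
  have hγd : ∀ᶠ s in 𝓝 (0 : ℝ), MDifferentiableAt 𝓘(ℝ, ℝ) 𝓘(ℝ, E) γ s :=
    hxs.mono fun s hs ↦ mdifferentiableAt_curry_left hs two_ne_zero
  have hrd : ∀ᶠ s in 𝓝 (0 : ℝ), MDifferentiableAt 𝓘(ℝ, ℝ) 𝓘(ℝ, E) (x s) 0 :=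
    hxs.mono fun s hs ↦ mdifferentiableAt_curry_right hs two_ne_zero
  have hsrc : ∀ᶠ s in 𝓝 (0 : ℝ), γ s ∈ (chartAt E (γ 0)).source :=
    (hγd.self_of_nhds).continuousAt.preimage_mem_nhds
      ((chartAt E (γ 0)).open_source.mem_nhds (mem_chart_source E (γ 0)))
  -- the chart expression of `Φ` along the lines: `φ (x s r) = ψ (s + r)`
  have hψsr : ∀ s r : ℝ, extChartAt 𝓘(ℝ, E) (γ 0) (x s r) = ψ (s + r) := fun s r ↦ by
    show extChartAt 𝓘(ℝ, E) (γ 0) (Φ (ξ₀ + s • e + r • e)) =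
      extChartAt 𝓘(ℝ, E) (γ 0) (Φ (ξ₀ + (s + r) • e))
    rw [add_smul, add_assoc]
  -- the trivialised `∂_r x(s, 0)` is `ψ' s`
  set w : ℝ → E := fun s ↦ (ex ⟨x s 0, velocity 𝓘(ℝ, E) (x s) 0⟩).2 with hw
  have hwψ : w =ᶠ[𝓝 0] deriv ψ := by
    filter_upwards [hrd, hsrc] with s hs hss
    rw [hw]
    show (ex ⟨x s 0, velocity 𝓘(ℝ, E) (x s) 0⟩).2 = deriv ψ s
    rw [hex, trivializationAt_velocity_curry_right hs hss]
    have hfun : (fun r ↦ extChartAt 𝓘(ℝ, E) (γ 0) (x s r)) = fun r ↦ ψ (s + r) := funext (hψsr s)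
    rw [hfun, deriv_comp_const_add ψ s 0, add_zero]
  -- `ψ` is `C²` near `0`; derivatives of `w`
  have hψ2 : ∀ᶠ t in 𝓝 (0 : ℝ), ContDiffAt ℝ 2 ψ t := by
    have hct : Tendsto (fun t : ℝ ↦ ξ₀ + t • e) (𝓝 0) (𝓝 ξ₀) := by
      have h : Continuous (fun t : ℝ ↦ ξ₀ + t • e) :=
        continuous_const.add (continuous_id.smul continuous_const)
      have h0 : ξ₀ + (0 : ℝ) • e = ξ₀ := by simp
      have h1 : ContinuousAt (fun t : ℝ ↦ ξ₀ + t • e) 0 := h.continuousAt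
      rwa [ContinuousAt, h0] at h1
    have hΦl : ∀ᶠ t in 𝓝 (0 : ℝ), ContMDiffAt 𝓘(ℝ, ℝ) 𝓘(ℝ, E) 2 (fun t : ℝ ↦ Φ (ξ₀ + t • e)) t := by
      filter_upwards [hct.eventually hΦ] with t ht
      exact ht.comp t ((contDiff_const.add (contDiff_id.smul contDiff_const)).contMDiff t |>.of_le h2le)
    have hsrc' : ∀ᶠ t in 𝓝 (0 : ℝ), Φ (ξ₀ + t • e) ∈ (chartAt E (γ 0)).source := by
      have hcont : ContinuousAt (fun t : ℝ ↦ Φ (ξ₀ + t • e)) 0 :=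
        (hΦl.self_of_nhds).continuousAt
      refine hcont.preimage_mem_nhds ((chartAt E (γ 0)).open_source.mem_nhds ?_)
      have : Φ (ξ₀ + (0 : ℝ) • e) = γ 0 := by simp [hγ, hx]
      rw [this]; exact mem_chart_source E (γ 0)
    filter_upwards [hΦl, hsrc'] with t ht hts
    have hchart : ContMDiffAt 𝓘(ℝ, E) 𝓘(ℝ, E) 2 (extChartAt 𝓘(ℝ, E) (γ 0)) (Φ (ξ₀ + t • e)) :=
      (contMDiffAt_extChartAt' hts).of_le h2le
    exact contMDiffAt_iff_contDiffAt.1 (hchart.comp t ht)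
  have hψd : ∀ᶠ t in 𝓝 (0 : ℝ), HasDerivAt ψ (deriv ψ t) t :=
    hψ2.mono fun t ht ↦ (ht.differentiableAt (by norm_num)).hasDerivAt
  have hψ'd : DifferentiableAt ℝ (deriv ψ) 0 := by
    have h := (hψ2.self_of_nhds).fderiv_right (m := 1) (by norm_num)
    have hd : deriv ψ = fun t ↦ fderiv ℝ ψ t 1 := by funext t; rfl
    rw [hd]
    exact (h.clm_apply contDiffAt_const).differentiableAt (by norm_num)
  have hwd : DifferentiableAt ℝ w 0 := hψ'd.congr_of_eventuallyEq hwψ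
  have hw' : deriv w 0 = deriv (deriv ψ) 0 := hwψ.deriv_eq
  have hw0 : w 0 = deriv ψ 0 := hwψ.self_of_nhds
  -- the field `∂_r x(s, 0)` in trivialised form near `0`
  have hfield : ∀ᶠ s in 𝓝 (0 : ℝ),
      velocity 𝓘(ℝ, E) (x s) 0 = ex.symmL ℝ (γ s) (w s) := by
    filter_upwards [hsrc] with s hss
    have hb : γ s ∈ ex.baseSet := by rw [hex]; simpa using hss
    have h := ex.symmL_continuousLinearMapAt (R := ℝ) hb (velocity 𝓘(ℝ, E) (x s) 0)
    rw [Trivialization.continuousLinearMapAt_apply_of_mem (R := ℝ) _ hb] at h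
    exact h.symm
  -- the chart formula
  have hformula := continuousLinearMapAt_covariantDerivAlong_symmL_Γmat g.leviCivita hreg (γ 0)
    (γ := γ) (t := 0) (mem_chart_source E (γ 0)) hγd.self_of_nhds hwd
  rw [covariantDerivAlong_congr_field g.leviCivita hfield]
  have hid := continuousLinearMapAt_of_eq (E := E) (M := M) (x₁ := γ 0) (p := γ 0) rfl
    (covariantDerivAlong g.leviCivita γ (fun s ↦ ex.symmL ℝ (γ s) (w s)) 0 : E)
  -- the velocity coordinates of `γ` at `0` are `ψ' 0`
  have hvel : (trivializationAt E (TangentSpace 𝓘(ℝ, E)) (γ 0) ⟨γ 0, velocity 𝓘(ℝ, E) γ 0⟩).2 =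
      deriv ψ 0 := by
    rw [show γ = (fun s ↦ x s 0) from rfl,
      trivializationAt_velocity_curry_left hγd.self_of_nhds (mem_chart_source E (γ 0))]
    have hfun : (fun t' ↦ extChartAt 𝓘(ℝ, E) (γ 0) (x t' 0)) = fun t' ↦ ψ (t' + 0) :=
      funext fun t' ↦ hψsr t' 0
    rw [hfun]
    simp only [add_zero]
  rw [← hid]
  refine hformula.trans ?_
  rw [hw', hw0, hvel]

/-! #### The comparison theorem -/

/-- **Touching hypersurfaces have ordered second fundamental forms.** Let `Ψ : ℝ × F → M` be
smooth near `(f₁ ξ₀, ξ₀)` ("graph coordinates" with vertical `τ`-lines), and let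
`Φᵢ(ξ) = Ψ(fᵢ ξ, ξ)`, `i = 1, 2`, be the graphs of two functions `fᵢ`, `C²` near `ξ₀`, which
**touch at `ξ₀` with `Φ₂` weakly below `Φ₁`**: `f₁ ξ₀ = f₂ ξ₀` and `f₂ ≤ f₁` near `ξ₀`. Let `Kᵢ` be
fields along `Φᵢ`, with differentiable lifts at `ξ₀`, normal to `Φᵢ` near `ξ₀`
(`g(Kᵢ, dΦᵢ w) = 0`), agreeing at the touching point, and pairing negatively with the vertical
`V = ∂_τ Ψ` there (`g(K, V) < 0`; e.g. `K` future causal and `V` future timelike). Then for every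
direction `e`,
`g(D_e K₂, dΦ₂ e) ≤ g(D_e K₁, dΦ₁ e)`:
the second fundamental forms with respect to `K` (in the tree's convention
`χ_K(v, w) = g(D_v K, dΦ w)`, `secondFundamentalForm`) are ordered, `χ₂(e, e) ≤ χ₁(e, e)`.
Proof: `χᵢ(e, e) = -g(K, accᵢ)` with `accᵢ` the acceleration of `Φᵢ` along the line
`ξ₀ + s e` (`val_normalDerivAlong_eq_neg_val_acceleration`); in the chart at the touching point
the two accelerations differ by `((f₂ - f₁) ∘ ℓ)''(0) · V` (`covariantDerivAlong_line_eq_chart`,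
`deriv_deriv_comp_curve`: equal 1-jets make the Christoffel and the second-order chain-rule terms
cancel), and `((f₁ - f₂) ∘ ℓ)''(0) ≥ 0` at the touching minimum
(`deriv_line_eq_and_deriv2_le_of_touching`). This is the geometric maximum-principle inequality
behind the comparison of null hypersurfaces (Galloway 2000, Ann. Henri Poincaré 1, §2, proof of
Thm. 2.1: "if `S₂` lies to the future side of `S₁` near `p` and touches at `p` then
`θ₂(p) ≥ θ₁(p)`", here for the second fundamental forms termwise; O'Neill 1983, Ch. 4, Cor. 9 and
Ch. 10, Lemma 33 for the underlying calculus). [cite: Galloway2000, §2, proof of Thm. 2.1] [cite: ONeillSemiRiemannian1983, Ch. 4, Cor. 9] -/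
theorem val_normalDerivAlong_le_of_touching (hreg : g.leviCivita.IsLocallyContMDiff ∞)
    {Ψ : ℝ × F → M} {f₁ f₂ : F → ℝ} {ξ₀ : F}
    (hΨ : ∀ᶠ q in 𝓝 ((f₁ ξ₀, ξ₀) : ℝ × F), ContMDiffAt 𝓘(ℝ, ℝ × F) 𝓘(ℝ, E) ∞ Ψ q)
    (hf₁ : ∀ᶠ ξ in 𝓝 ξ₀, ContDiffAt ℝ 2 f₁ ξ) (hf₂ : ∀ᶠ ξ in 𝓝 ξ₀, ContDiffAt ℝ 2 f₂ ξ)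
    (htouch : f₁ ξ₀ = f₂ ξ₀) (hle : ∀ᶠ ξ in 𝓝 ξ₀, f₂ ξ ≤ f₁ ξ)
    {K₁ : Π ξ : F, TangentSpace 𝓘(ℝ, E) (Ψ (f₁ ξ, ξ))}
    {K₂ : Π ξ : F, TangentSpace 𝓘(ℝ, E) (Ψ (f₂ ξ, ξ))}
    (hK₁ : MDifferentiableAt 𝓘(ℝ, F) 𝓘(ℝ, E).tangent
      (fun ξ ↦ (TotalSpace.mk' E (Ψ (f₁ ξ, ξ)) (K₁ ξ) : TangentBundle 𝓘(ℝ, E) M)) ξ₀)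
    (hK₂ : MDifferentiableAt 𝓘(ℝ, F) 𝓘(ℝ, E).tangent
      (fun ξ ↦ (TotalSpace.mk' E (Ψ (f₂ ξ, ξ)) (K₂ ξ) : TangentBundle 𝓘(ℝ, E) M)) ξ₀)
    (hKn₁ : ∀ᶠ ξ in 𝓝 ξ₀, ∀ w : F, g.val (Ψ (f₁ ξ, ξ)) (K₁ ξ)
      (mfderiv 𝓘(ℝ, F) 𝓘(ℝ, E) (fun ξ ↦ Ψ (f₁ ξ, ξ)) ξ w) = 0)
    (hKn₂ : ∀ᶠ ξ in 𝓝 ξ₀, ∀ w : F, g.val (Ψ (f₂ ξ, ξ)) (K₂ ξ)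
      (mfderiv 𝓘(ℝ, F) 𝓘(ℝ, E) (fun ξ ↦ Ψ (f₂ ξ, ξ)) ξ w) = 0)
    (hK0 : (K₁ ξ₀ : E) = K₂ ξ₀)
    (hKV : g.val (Ψ (f₁ ξ₀, ξ₀)) (K₁ ξ₀) (velocity 𝓘(ℝ, E) (fun τ : ℝ ↦ Ψ (τ, ξ₀)) (f₁ ξ₀)) < 0)
    (e : F) :
    g.val (Ψ (f₂ ξ₀, ξ₀)) (g.normalDerivAlong (I' := 𝓘(ℝ, F)) (fun ξ ↦ Ψ (f₂ ξ, ξ)) K₂ ξ₀ e)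
        (mfderiv 𝓘(ℝ, F) 𝓘(ℝ, E) (fun ξ ↦ Ψ (f₂ ξ, ξ)) ξ₀ e) ≤
      g.val (Ψ (f₁ ξ₀, ξ₀)) (g.normalDerivAlong (I' := 𝓘(ℝ, F)) (fun ξ ↦ Ψ (f₁ ξ, ξ)) K₁ ξ₀ e)
        (mfderiv 𝓘(ℝ, F) 𝓘(ℝ, E) (fun ξ ↦ Ψ (f₁ ξ, ξ)) ξ₀ e) := by
  have h2le : (2 : ℕ∞ω) ≤ ∞ := WithTop.coe_le_coe.2 le_top
  set Φ₁ : F → M := fun ξ ↦ Ψ (f₁ ξ, ξ) with hΦ₁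
  set Φ₂ : F → M := fun ξ ↦ Ψ (f₂ ξ, ξ) with hΦ₂
  have hpt0 : ξ₀ + (0 : ℝ) • e + (0 : ℝ) • e = ξ₀ := by simp
  -- `Φᵢ` is `C²` near `ξ₀`
  have hm : ∀ {f : F → ℝ}, (∀ᶠ ξ in 𝓝 ξ₀, ContDiffAt ℝ 2 f ξ) → f ξ₀ = f₁ ξ₀ →
      ∀ᶠ ξ in 𝓝 ξ₀, ContMDiffAt 𝓘(ℝ, F) 𝓘(ℝ, E) 2 (fun ξ ↦ Ψ (f ξ, ξ)) ξ := by
    intro f hf hf0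
    have hmc : ContinuousAt (fun ξ ↦ ((f ξ, ξ) : ℝ × F)) ξ₀ :=
      (hf.self_of_nhds).continuousAt.prodMk continuousAt_id
    have hev : ∀ᶠ ξ in 𝓝 ξ₀, ContMDiffAt 𝓘(ℝ, ℝ × F) 𝓘(ℝ, E) ∞ Ψ (f ξ, ξ) := by
      have h0 : ((f ξ₀, ξ₀) : ℝ × F) = (f₁ ξ₀, ξ₀) := by rw [hf0]
      have hmc' : Tendsto (fun ξ ↦ ((f ξ, ξ) : ℝ × F)) (𝓝 ξ₀) (𝓝 (f₁ ξ₀, ξ₀)) := by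
        rw [← h0]; exact hmc
      exact hmc'.eventually hΨ
    filter_upwards [hf, hev] with ξ hfξ hΨξ
    have hmξ : ContMDiffAt 𝓘(ℝ, F) 𝓘(ℝ, ℝ × F) 2 (fun ξ ↦ ((f ξ, ξ) : ℝ × F)) ξ :=
      contMDiffAt_iff_contDiffAt.2 (hfξ.prodMk contDiffAt_id)
    exact ContMDiffAt.comp (f := fun ξ ↦ ((f ξ, ξ) : ℝ × F)) ξ (hΨξ.of_le h2le) hmξ
  have hΦ₁s : ∀ᶠ ξ in 𝓝 ξ₀, ContMDiffAt 𝓘(ℝ, F) 𝓘(ℝ, E) 2 Φ₁ ξ := hm hf₁ rfl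
  have hΦ₂s : ∀ᶠ ξ in 𝓝 ξ₀, ContMDiffAt 𝓘(ℝ, F) 𝓘(ℝ, E) 2 Φ₂ ξ := hm hf₂ htouch.symm
  -- Lemma A: `χᵢ(e, e) = -g(Kᵢ, accᵢ)`
  rw [val_normalDerivAlong_eq_neg_val_acceleration g hΦ₁s hK₁ hKn₁ e,
    val_normalDerivAlong_eq_neg_val_acceleration g hΦ₂s hK₂ hKn₂ e]
  -- Lemma B: chart formula for the accelerations, in the chart at the touching point `Φ₁ pt`
  have hbase : Φ₂ (ξ₀ + (0 : ℝ) • e + (0 : ℝ) • e) = Φ₁ (ξ₀ + (0 : ℝ) • e + (0 : ℝ) • e) := by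
    simp only [hΦ₁, hΦ₂, hpt0, htouch]
  have hB₁ := covariantDerivAlong_line_eq_chart g hreg e hΦ₁s
    (x₁ := Φ₁ (ξ₀ + (0 : ℝ) • e + (0 : ℝ) • e)) rfl
  have hB₂ := covariantDerivAlong_line_eq_chart g hreg e hΦ₂s
    (x₁ := Φ₁ (ξ₀ + (0 : ℝ) • e + (0 : ℝ) • e)) hbase
  -- Lemma C: the chart expressions `ψᵢ = G ∘ αᵢ`, `G = φ ∘ Ψ`, `αᵢ(t) = (fᵢ(ξ₀ + t e), ξ₀ + t e)`
  set x₁ : M := Φ₁ (ξ₀ + (0 : ℝ) • e + (0 : ℝ) • e) with hx₁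
  have hx₁' : Ψ (f₁ ξ₀, ξ₀) = x₁ := by simp [hx₁, hΦ₁]
  set G : ℝ × F → E := fun q ↦ extChartAt 𝓘(ℝ, E) x₁ (Ψ q) with hG
  have hGs : ∀ᶠ q in 𝓝 ((f₁ ξ₀, ξ₀) : ℝ × F), ContDiffAt ℝ 2 G q := by
    have hcont : ContinuousAt Ψ (f₁ ξ₀, ξ₀) := (hΨ.self_of_nhds).continuousAt
    have hsrc : ∀ᶠ q in 𝓝 ((f₁ ξ₀, ξ₀) : ℝ × F), Ψ q ∈ (chartAt E x₁).source := by
      refine hcont.preimage_mem_nhds ((chartAt E x₁).open_source.mem_nhds ?_)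
      rw [hx₁']; exact mem_chart_source E x₁
    filter_upwards [hΨ, hsrc] with q hq hqs
    exact contMDiffAt_iff_contDiffAt.1
      (((contMDiffAt_extChartAt' hqs).of_le h2le).comp q (hq.of_le h2le))
  have hℓd : ∀ t : ℝ, HasDerivAt (fun t : ℝ ↦ ξ₀ + t • e) e t := fun t ↦ by
    have h : HasDerivAt (fun y : ℝ ↦ ξ₀ + y • e) ((1 : ℝ) • e) t :=
      ((hasDerivAt_id' t).smul_const e).const_add ξ₀
    rw [one_smul] at h
    exact h
  obtain ⟨hℓ₁, hℓ₁'⟩ := hasDerivAt_line_of_contDiffAt hf₁ e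
  obtain ⟨hℓ₂, hℓ₂'⟩ := hasDerivAt_line_of_contDiffAt hf₂ e
  obtain ⟨hd1eq, hd2le⟩ := deriv_line_eq_and_deriv2_le_of_touching hf₁ hf₂ htouch hle e
  have hα : ∀ {f : F → ℝ}, (∀ᶠ s in 𝓝 (0 : ℝ), HasDerivAt (fun s : ℝ ↦ f (ξ₀ + s • e))
      (deriv (fun s : ℝ ↦ f (ξ₀ + s • e)) s) s) →
      ∀ᶠ t in 𝓝 (0 : ℝ), HasDerivAt (fun t : ℝ ↦ ((f (ξ₀ + t • e), ξ₀ + t • e) : ℝ × F))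
        (deriv (fun s : ℝ ↦ f (ξ₀ + s • e)) t, e) t :=
    fun h ↦ h.mono fun t ht ↦ ht.prodMk (hℓd t)
  have hα' : ∀ {f : F → ℝ}, HasDerivAt (deriv fun s : ℝ ↦ f (ξ₀ + s • e))
      (deriv (deriv fun s : ℝ ↦ f (ξ₀ + s • e)) 0) 0 →
      HasDerivAt (fun t : ℝ ↦ ((deriv (fun s : ℝ ↦ f (ξ₀ + s • e)) t, e) : ℝ × F))
        (deriv (deriv fun s : ℝ ↦ f (ξ₀ + s • e)) 0, 0) 0 :=
    fun h ↦ h.prodMk (hasDerivAt_const 0 e)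
  have hα0 : ∀ {f : F → ℝ}, f ξ₀ = f₁ ξ₀ →
      ((f (ξ₀ + (0 : ℝ) • e), ξ₀ + (0 : ℝ) • e) : ℝ × F) = (f₁ ξ₀, ξ₀) := fun h ↦ by simp [h]
  obtain ⟨-, hψ₁', hψ₁''⟩ := deriv_deriv_comp_curve (G := G) hGs (hα hℓ₁) (hα' hℓ₁') (hα0 rfl)
  obtain ⟨-, hψ₂', hψ₂''⟩ :=
    deriv_deriv_comp_curve (G := G) hGs (hα hℓ₂) (hα' hℓ₂') (hα0 htouch.symm)
  have hGα₁ : (fun t : ℝ ↦ extChartAt 𝓘(ℝ, E) x₁ (Φ₁ (ξ₀ + t • e))) =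
      G ∘ fun t : ℝ ↦ ((f₁ (ξ₀ + t • e), ξ₀ + t • e) : ℝ × F) := rfl
  have hGα₂ : (fun t : ℝ ↦ extChartAt 𝓘(ℝ, E) x₁ (Φ₂ (ξ₀ + t • e))) =
      G ∘ fun t : ℝ ↦ ((f₂ (ξ₀ + t • e), ξ₀ + t • e) : ℝ × F) := rfl
  rw [hGα₁, hψ₁', hψ₁''] at hB₁
  rw [hGα₂, hψ₂', hψ₂''] at hB₂
  -- the vertical: `DG(p)(1, 0) = V`
  have hDG : fderiv ℝ G (f₁ ξ₀, ξ₀) ((1 : ℝ), (0 : F)) =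
      (velocity 𝓘(ℝ, E) (fun τ : ℝ ↦ Ψ (τ, ξ₀)) (f₁ ξ₀) : E) := by
    have hGd : DifferentiableAt ℝ G (f₁ ξ₀, ξ₀) :=
      (hGs.self_of_nhds).differentiableAt (by norm_num)
    have hτ : HasDerivAt (fun τ : ℝ ↦ ((τ, ξ₀) : ℝ × F)) ((1 : ℝ), (0 : F)) (f₁ ξ₀) :=
      (hasDerivAt_id' _).prodMk (hasDerivAt_const _ _)
    rw [← (hGd.hasFDerivAt.comp_hasDerivAt (f₁ ξ₀) hτ).deriv]
    have hvert : MDifferentiableAt 𝓘(ℝ, ℝ) 𝓘(ℝ, E) (fun τ : ℝ ↦ Ψ (τ, ξ₀)) (f₁ ξ₀) := by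
      have hin : ContMDiffAt 𝓘(ℝ, ℝ) 𝓘(ℝ, ℝ × F) ∞ (fun τ : ℝ ↦ ((τ, ξ₀) : ℝ × F)) (f₁ ξ₀) :=
        contMDiffAt_iff_contDiffAt.2 (contDiffAt_id.prodMk contDiffAt_const)
      exact ((hΨ.self_of_nhds).comp (f₁ ξ₀) hin).mdifferentiableAt (by simp)
    have hsrc0 : Ψ (f₁ ξ₀, ξ₀) ∈ (chartAt E x₁).source := by
      rw [hx₁']; exact mem_chart_source E x₁
    have h2 := (hasDerivAt_extChartAt_comp (I := 𝓘(ℝ, E)) hvert hsrc0).deriv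
    rw [show (G ∘ fun τ : ℝ ↦ ((τ, ξ₀) : ℝ × F)) =
      extChartAt 𝓘(ℝ, E) x₁ ∘ (fun τ : ℝ ↦ Ψ (τ, ξ₀)) from rfl, h2]
    exact trivializationAt_snd_of_eq hx₁' _
  -- transport everything to the touching point `x₁`, normal `K₁ pt`
  have hKpt : (K₂ (ξ₀ + (0 : ℝ) • e + (0 : ℝ) • e) : E) = K₁ (ξ₀ + (0 : ℝ) • e + (0 : ℝ) • e) := by
    rw [field_congr_point K₂ hpt0, field_congr_point K₁ hpt0, hK0]
  have hKV' : g.val x₁ (K₁ (ξ₀ + (0 : ℝ) • e + (0 : ℝ) • e))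
      (velocity 𝓘(ℝ, E) (fun τ : ℝ ↦ Ψ (τ, ξ₀)) (f₁ ξ₀)) < 0 := by
    rw [← val_congr_point g hx₁', field_congr_point K₁ hpt0]
    exact hKV
  rw [val_congr_point g hbase (K₂ (ξ₀ + (0 : ℝ) • e + (0 : ℝ) • e)), hKpt]
  -- read the accelerations in `E` and subtract
  set V : E := (velocity 𝓘(ℝ, E) (fun τ : ℝ ↦ Ψ (τ, ξ₀)) (f₁ ξ₀) : E) with hV
  set δ : ℝ := deriv (deriv fun s : ℝ ↦ f₂ (ξ₀ + s • e)) 0 -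
    deriv (deriv fun s : ℝ ↦ f₁ (ξ₀ + s • e)) 0 with hδ
  obtain ⟨a₁, ha₁⟩ : ∃ a : E, a = covariantDerivAlong g.leviCivita
      (fun s : ℝ ↦ Φ₁ (ξ₀ + s • e + (0 : ℝ) • e))
      (fun s ↦ velocity 𝓘(ℝ, E) (fun r : ℝ ↦ Φ₁ (ξ₀ + s • e + r • e)) 0) 0 := ⟨_, rfl⟩
  obtain ⟨a₂, ha₂⟩ : ∃ a : E, a = covariantDerivAlong g.leviCivita
      (fun s : ℝ ↦ Φ₂ (ξ₀ + s • e + (0 : ℝ) • e))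
      (fun s ↦ velocity 𝓘(ℝ, E) (fun r : ℝ ↦ Φ₂ (ξ₀ + s • e + r • e)) 0) 0 := ⟨_, rfl⟩
  rw [← ha₁] at hB₁ ⊢
  rw [← ha₂] at hB₂ ⊢
  have hdiff : a₂ = a₁ + δ • V := by
    rw [hB₁, hB₂, hd1eq, ← hDG, hδ]
    have hlin : fderiv ℝ G (f₁ ξ₀, ξ₀)
        ((deriv (deriv fun s : ℝ ↦ f₂ (ξ₀ + s • e)) 0, (0 : F)) : ℝ × F) =
        fderiv ℝ G (f₁ ξ₀, ξ₀)
          ((deriv (deriv fun s : ℝ ↦ f₁ (ξ₀ + s • e)) 0, (0 : F)) : ℝ × F) +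
        (deriv (deriv fun s : ℝ ↦ f₂ (ξ₀ + s • e)) 0 -
          deriv (deriv fun s : ℝ ↦ f₁ (ξ₀ + s • e)) 0) •
          fderiv ℝ G (f₁ ξ₀, ξ₀) ((1 : ℝ), (0 : F)) := by
      rw [← map_smul, ← map_add]
      congr 1
      ext <;> simp
    rw [hlin]
    abel
  have hδ0 : δ ≤ 0 := by rw [hδ]; linarith
  -- conclude, reading the pairing with `K` as a linear form on `E`
  set L : E →L[ℝ] ℝ := g.val x₁ (K₁ (ξ₀ + (0 : ℝ) • e + (0 : ℝ) • e)) with hL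
  have hKV'' : L V < 0 := hKV'
  show -(L _) ≤ -(L _)
  rw [hdiff, map_add, map_smul, smul_eq_mul]
  nlinarith [mul_nonneg_of_nonpos_of_nonpos hδ0 hKV''.le]

end Comparison

end Literature.Geometry.Lorentzian

end
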